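import Literature.Analysis.SpecialFunctions.RealGaussianComplexQuadratic
import HarnessLib

/-!
# Spin-wave (Gaussian) complex stability: a lattice Gaussian field tilted by a complex two-gradient kernel is zero-free

Topic `Probability/LatticeModels`. The Gaussian ("spin-wave") caricature of a low-temperature
lattice spin model with stiffness `J` on a finite graph is the measure
`exp(−(J/2) Σ_b (∇φ)_b²) dφ` on the pinned field `φ : n → ℝ` (`∇ = D : ℝⁿ → ℝ^E` an injective
real "gradient" matrix, `E` = bonds). A complex TWO-CURRENT / two-gradient perturbation is
`W_K(φ) = Σ_{b,b'} K(b,b') (∇φ)_b (∇φ)_{b'}` with a complex bond kernel `K`. THEOREM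
(`integral_cexp_spinWave_twoGradient_ne_zero`): if the Schur norm of `K` (max row / column sum of
`‖K(b,b')‖`) is `≤ κ` and `2κ < J`, then

  `∫ exp(−(J/2)‖∇φ‖² + W_K(φ)) dφ ≠ 0`,

for EVERY finite graph — i.e. uniformly in the volume. This is the precise form of the folklore
statement "the complex Gaussian integral `det(1 − 2KC)^{-1/2}` never vanishes while `2‖K‖ < J`"
(e.g. `Summits/HubbardSuperconductivity/…/Cruxes/PerturbedXYOrder/Disproof.lean` §5.3, and the
`det(1 − 2KC)`, radius `J > 2εS_∞` step of the crux-idea cards `villain-unfold-dipole-rg`,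
`schwarz-inheritance` for crux `…Theses.NodalWardXY.PerturbedXYOrder`): for kernels
`‖K(b,b')‖ ≤ ε(1 + dist(b,b'))⁻⁴` on `(ℤ/Lℤ)³` the Schur norm is `≤ ε S_L ≤ 3ε Σ_{x∈ℤ³}(1+|x|₁)⁻⁴`,
bounded uniformly in `L`, so the spin-wave level of that crux's "complex stability" holds with
`ε₂ = J₀/(2 sup_L S_L)`; what the crux adds (and what is open) is the non-Gaussian part (cosine
anharmonicity, vortices, the compact angle cube) uniformly in `L`.

Proof: the exponent is `−½ φᵀAφ + φᵀMφ` with `A = J DᵀD` and the complex symmetric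
`M = Dᵀ K_s D`, `K_s = (K + Kᵀ)/2`; the Schur test gives `|Re φᵀMφ| ≤ κ‖Dφ‖²`, so
`A − 2 Re M ≥ (J − 2κ) DᵀD ≻ 0` (`D` injective), and the branch-free Gaussian formula
`(∫ e^{−φᵀAφ/2 + φᵀMφ})² det(A − 2M) = (2π)ⁿ`
(`Literature.Analysis.SpecialFunctions.integral_cexp_neg_half_add_quadratic_ne_zero`) forbids a zero.

## Contents
* `abs_sum_sum_mul_mul_le_of_schur` — Schur test for a real bilinear form;
* `re_sum_sum_mul_mul_le_of_schur` — `Re Σ K y y ≤ κ ‖y‖²` for real `y`;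
* `integral_cexp_spinWave_twoGradient_ne_zero` — the theorem.
-/

noncomputable section

namespace Literature.Probability.LatticeModels

open MeasureTheory Matrix Complex Literature.Analysis.SpecialFunctions
open scoped BigOperators ComplexOrder MatrixOrder Real

variable {n E : Type*} [Fintype n] [Fintype E] [DecidableEq n]

omit [Fintype n] [DecidableEq n] in
/-- **Schur test** for a real bilinear form: if every row sum and every column sum of `|R|` is at
most `κ`, then `|Σ_{b,b'} R_{bb'} y_b y_{b'}| ≤ κ Σ_b y_b²`. [folklore] -/
theorem abs_sum_sum_mul_mul_le_of_schur (R : Matrix E E ℝ) {κ : ℝ} (hrow : ∀ b, ∑ b', |R b b'| ≤ κ)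
    (hcol : ∀ b', ∑ b, |R b b'| ≤ κ) (y : E → ℝ) :
    |∑ b, ∑ b', R b b' * y b * y b'| ≤ κ * ∑ b, y b ^ 2 := by
  have hκ : ∀ b, 0 ≤ κ := fun b => le_trans (Finset.sum_nonneg fun b' _ => abs_nonneg (R b b')) (hrow b)
  calc |∑ b, ∑ b', R b b' * y b * y b'|
      ≤ ∑ b, ∑ b', |R b b'| * ((y b ^ 2 + y b' ^ 2) / 2) := by
        refine le_trans (Finset.abs_sum_le_sum_abs _ _) (Finset.sum_le_sum fun b _ => ?_)
        refine le_trans (Finset.abs_sum_le_sum_abs _ _) (Finset.sum_le_sum fun b' _ => ?_)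
        rw [abs_mul, abs_mul, mul_assoc]
        refine mul_le_mul_of_nonneg_left ?_ (abs_nonneg _)
        -- `|y_b| |y_b'| ≤ (y_b² + y_b'²)/2`
        nlinarith [sq_nonneg (|y b| - |y b'|), sq_abs (y b), sq_abs (y b')]
    _ = (∑ b, ∑ b', |R b b'| * y b ^ 2) / 2 + (∑ b', ∑ b, |R b b'| * y b' ^ 2) / 2 := by
        rw [Finset.sum_comm (f := fun b' b => |R b b'| * y b' ^ 2), ← add_div, ← Finset.sum_add_distrib,
          Finset.sum_div]
        refine Finset.sum_congr rfl fun b _ => ?_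
        rw [← Finset.sum_add_distrib, Finset.sum_div]
        exact Finset.sum_congr rfl fun b' _ => by ring
    _ = (∑ b, (∑ b', |R b b'|) * y b ^ 2) / 2 + (∑ b', (∑ b, |R b b'|) * y b' ^ 2) / 2 := by
        simp only [Finset.sum_mul]
    _ ≤ (∑ b, κ * y b ^ 2) / 2 + (∑ b', κ * y b' ^ 2) / 2 := by
        gcongr with b _ b' _
        · exact hrow b
        · exact hcol b'
    _ = κ * ∑ b, y b ^ 2 := by rw [← Finset.mul_sum]; ring

omit [Fintype n] [DecidableEq n] in
/-- For a complex kernel with Schur norm `≤ κ` and a REAL vector `y`: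
`Re Σ_{b,b'} K_{bb'} y_b y_{b'} ≤ κ Σ_b y_b²`. [folklore] -/
theorem re_sum_sum_mul_mul_le_of_schur (K : Matrix E E ℂ) {κ : ℝ} (hrow : ∀ b, ∑ b', ‖K b b'‖ ≤ κ)
    (hcol : ∀ b', ∑ b, ‖K b b'‖ ≤ κ) (y : E → ℝ) :
    (∑ b, ∑ b', K b b' * (y b : ℂ) * (y b' : ℂ)).re ≤ κ * ∑ b, y b ^ 2 := by
  have hre : (∑ b, ∑ b', K b b' * (y b : ℂ) * (y b' : ℂ)).re = ∑ b, ∑ b', (K b b').re * y b * y b' := by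
    simp [Complex.re_sum, Complex.mul_re]
  rw [hre]
  refine le_trans (le_abs_self _) (abs_sum_sum_mul_mul_le_of_schur (K.map Complex.re) ?_ ?_ y)
  · intro b
    refine le_trans (Finset.sum_le_sum fun b' _ => ?_) (hrow b)
    exact Complex.abs_re_le_norm (K b b')
  · intro b'
    refine le_trans (Finset.sum_le_sum fun b _ => ?_) (hcol b')
    exact Complex.abs_re_le_norm (K b b')

omit [Fintype n] [DecidableEq n] in
/-- Symmetrising the kernel does not change the bilinear form on the diagonal:
`Σ ((K + Kᵀ)/2)_{bb'} y_b y_{b'} = Σ K_{bb'} y_b y_{b'}`. [folklore] -/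
theorem sum_sum_symmetrise_mul_mul (K : Matrix E E ℂ) (y : E → ℂ) :
    ∑ b, ∑ b', ((1 / 2 : ℂ) • (K + Kᵀ)) b b' * y b * y b' = ∑ b, ∑ b', K b b' * y b * y b' := by
  have hT : ∑ b, ∑ b', Kᵀ b b' * y b * y b' = ∑ b, ∑ b', K b b' * y b * y b' := by
    rw [Finset.sum_comm]
    exact Finset.sum_congr rfl fun b _ => Finset.sum_congr rfl fun b' _ => by
      rw [Matrix.transpose_apply]; ring
  calc ∑ b, ∑ b', ((1 / 2 : ℂ) • (K + Kᵀ)) b b' * y b * y b'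
      = (1 / 2) * (∑ b, ∑ b', K b b' * y b * y b') + (1 / 2) * (∑ b, ∑ b', Kᵀ b b' * y b * y b') := by
        simp only [Matrix.smul_apply, Matrix.add_apply, smul_eq_mul, Finset.mul_sum, ← Finset.sum_add_distrib]
        exact Finset.sum_congr rfl fun b _ => Finset.sum_congr rfl fun b' _ => by ring
    _ = ∑ b, ∑ b', K b b' * y b * y b' := by rw [hT]; ring

omit [DecidableEq n] in
/-- The two-gradient form as a quadratic form in the field: with `M = Dᵀ K_s D` (complexified `D`),
`xᵀMx = Σ_{b,b'} K_{bb'} (Dx)_b (Dx)_{b'}` for real `x`. [folklore] -/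
theorem dotProduct_twoGradient_eq (D : Matrix E n ℝ) (K : Matrix E E ℂ) (x : n → ℝ) :
    (fun i => (x i : ℂ)) ⬝ᵥ (((D.map Complex.ofReal)ᵀ * ((1 / 2 : ℂ) • (K + Kᵀ)) * D.map Complex.ofReal) *ᵥ
        fun i => (x i : ℂ)) = ∑ b, ∑ b', K b b' * ((D *ᵥ x) b : ℂ) * ((D *ᵥ x) b' : ℂ) := by
  set Ks : Matrix E E ℂ := (1 / 2 : ℂ) • (K + Kᵀ) with hKs
  have hDx : (D.map Complex.ofReal) *ᵥ (fun i => (x i : ℂ)) = fun b => ((D *ᵥ x) b : ℂ) := by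
    funext b
    simp [Matrix.mulVec, dotProduct, Matrix.map_apply]
  rw [← Matrix.mulVec_mulVec, ← Matrix.mulVec_mulVec, hDx, Matrix.dotProduct_mulVec,
    Matrix.vecMul_transpose, hDx, ← sum_sum_symmetrise_mul_mul K, ← hKs]
  simp only [dotProduct, Matrix.mulVec, Finset.mul_sum]
  exact Finset.sum_congr rfl fun b _ => Finset.sum_congr rfl fun b' _ => by ring

/-- **Spin-wave complex stability (zero-freeness, uniform in the volume).** Let `D : ℝⁿ → ℝ^E` be an
injective real matrix (the gradient of a pinned / massless-mode-free lattice field), `J > 2κ ≥ 0`,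
and `K` a complex bond kernel whose row and column sums of `‖K(b,b')‖` are `≤ κ`. Then the Gaussian
field with stiffness `J` tilted by the complex two-gradient form `W_K(φ) = Σ K(b,b') (Dφ)_b (Dφ)_{b'}`
has a non-vanishing partition function:
`∫_{ℝⁿ} exp(−(J/2) Σ_b (Dφ)_b² + W_K(φ)) dφ ≠ 0`.
(Gaussian / spin-wave level of "complex stability" of two-current perturbations; the interacting
statement for the 3D rotator is crux `…Theses.NodalWardXY.PerturbedXYOrder`.) [folklore] -/
theorem integral_cexp_spinWave_twoGradient_ne_zero (D : Matrix E n ℝ) (hD : Function.Injective D.mulVec)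
    {J κ : ℝ} (hJ : 2 * κ < J) (K : Matrix E E ℂ) (hrow : ∀ b, ∑ b', ‖K b b'‖ ≤ κ)
    (hcol : ∀ b', ∑ b, ‖K b b'‖ ≤ κ) :
    (∫ x : n → ℝ, cexp (-((J / 2 : ℝ) : ℂ) * ((∑ b, (D *ᵥ x) b ^ 2 : ℝ) : ℂ) +
        ∑ b, ∑ b', K b b' * ((D *ᵥ x) b : ℂ) * ((D *ᵥ x) b' : ℂ))) ≠ 0 := by
  -- the Gaussian data
  set A : Matrix n n ℝ := J • (Dᵀ * D) with hA
  set Ks : Matrix E E ℂ := (1 / 2 : ℂ) • (K + Kᵀ) with hKs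
  set M : Matrix n n ℂ := (D.map Complex.ofReal)ᵀ * Ks * D.map Complex.ofReal with hM
  have hKs_symm : Ks.IsSymm := by
    show Ksᵀ = Ks
    rw [hKs, Matrix.transpose_smul, Matrix.transpose_add, Matrix.transpose_transpose, add_comm]
  have hM_symm : M.IsSymm := by
    show Mᵀ = M
    rw [hM, Matrix.transpose_mul, Matrix.transpose_mul, Matrix.transpose_transpose, hKs_symm.eq,
      Matrix.mul_assoc]
  -- `xᵀDᵀDx = ‖Dx‖²`, `xᵀAx = J ‖Dx‖²`
  have hformDD : ∀ x : n → ℝ, x ⬝ᵥ ((Dᵀ * D) *ᵥ x) = ∑ b, (D *ᵥ x) b ^ 2 := fun x => by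
    rw [← Matrix.mulVec_mulVec, Matrix.dotProduct_mulVec, Matrix.vecMul_transpose]
    simp [dotProduct, pow_two]
  have hformA : ∀ x : n → ℝ, x ⬝ᵥ (A *ᵥ x) = J * ∑ b, (D *ᵥ x) b ^ 2 := fun x => by
    rw [hA, Matrix.smul_mulVec, dotProduct_smul, smul_eq_mul, hformDD]
  -- `xᵀMx = Σ K (Dx)(Dx)`
  have hformM : ∀ x : n → ℝ, (fun i => (x i : ℂ)) ⬝ᵥ (M *ᵥ fun i => (x i : ℂ)) =
      ∑ b, ∑ b', K b b' * ((D *ᵥ x) b : ℂ) * ((D *ᵥ x) b' : ℂ) := fun x => dotProduct_twoGradient_eq D K x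
  -- positivity of `A − 2 Re M`
  have hPD : (A - (2 : ℝ) • M.map Complex.re).PosDef := by
    refine Matrix.PosDef.of_dotProduct_mulVec_pos ?_ fun x hx => ?_
    · -- real symmetric
      have hDD : (Dᵀ * D).IsSymm := by
        rw [Matrix.IsSymm, Matrix.transpose_mul, Matrix.transpose_transpose]
      have hs : (J • (Dᵀ * D) - (2 : ℝ) • M.map Complex.re).IsSymm :=
        (hDD.smul J).sub ((hM_symm.map Complex.re).smul (2 : ℝ))
      show (A - (2 : ℝ) • M.map Complex.re)ᴴ = A - (2 : ℝ) • M.map Complex.re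
      rw [hA, Matrix.conjTranspose_eq_transpose_of_trivial, hs.eq]
    · have hreM : x ⬝ᵥ (M.map Complex.re *ᵥ x) =
          (∑ b, ∑ b', K b b' * ((D *ᵥ x) b : ℂ) * ((D *ᵥ x) b' : ℂ)).re := by
        rw [← hformM x, dotProduct_mulVec_ofReal_eq]
        simp
      have hDx : D *ᵥ x ≠ 0 := fun h => hx (hD (by rw [h, Matrix.mulVec_zero]))
      have hpos : 0 < ∑ b, (D *ᵥ x) b ^ 2 := by
        obtain ⟨b, hb⟩ := Function.ne_iff.mp hDx
        have hb' : (D *ᵥ x) b ≠ 0 := by simpa using hb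
        exact lt_of_lt_of_le (by positivity) (Finset.single_le_sum (fun b' _ => sq_nonneg ((D *ᵥ x) b'))
          (Finset.mem_univ b))
      have hre := re_sum_sum_mul_mul_le_of_schur K hrow hcol (D *ᵥ x)
      rw [star_trivial, hA, Matrix.sub_mulVec, dotProduct_sub, Matrix.smul_mulVec, dotProduct_smul,
        Matrix.smul_mulVec, dotProduct_smul, smul_eq_mul, smul_eq_mul, hformDD, hreM]
      nlinarith
  -- rewrite the integrand into the library's shape and conclude
  have hint : ∀ x : n → ℝ,
      -((J / 2 : ℝ) : ℂ) * ((∑ b, (D *ᵥ x) b ^ 2 : ℝ) : ℂ) + ∑ b, ∑ b', K b b' * ((D *ᵥ x) b : ℂ) * ((D *ᵥ x) b' : ℂ)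
        = -(1 / 2 : ℂ) * ((x ⬝ᵥ (A *ᵥ x) : ℝ) : ℂ) + (fun i => (x i : ℂ)) ⬝ᵥ (M *ᵥ fun i => (x i : ℂ)) := fun x => by
    rw [hformA, hformM]
    push_cast
    ring
  simp_rw [hint]
  exact (integral_cexp_neg_half_add_quadratic_ne_zero hM_symm hPD).1

end Literature.Probability.LatticeModels

end
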